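import Summits.ResolutionOfSingularities.ResolutionOfSingularities.Theorems.WeightedInvariantWeightedConstructionCobordantPlusBasicOpen
import Summits.ResolutionOfSingularities.ResolutionOfSingularities.Theorems.WeightedInvariantWeightedConstructionStrictTransformLocalization

/-!
# Open pieces of the cobordant blow-up: `B₊(D(h)) ↪ B₊(U)`, unconditional

Route `ResolutionOfSingularities/WeightedInvariant`, crux `WeightedConstruction`
(stmt-ResolutionOfSingularities-0571), line `no-phi-rays-static-drop` (lead c2), registered stub
`stub_openPieces`: the landed conditional open-piece theorem
`stub_cobordantPlus_basicOpen_openImmersion` (Theorems/…CobordantPlusBasicOpen.lean, line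
`support-first-weights-second`) with its ring hypothesis — vertices and strict transforms under
localisation of the base — discharged by the landed `stub_strictTransform_localization`
(Theorems/…StrictTransformLocalization.lean). For a Rees algebra `R` on `Y`, an affine open `U`,
`h ∈ Γ(Y, U)` and an ideal sheaf `X`: an open immersion `j : B₊(D(h)) → B₊(U)` over `Y` matching strict
transforms and exceptional divisors, onto the points of `B₊(U)` over `D(h)` (Włodarczyk,
arXiv:2203.03090, Def. 2.3.5, 3.3.12–3.3.13, App. Def. 5.1.1). This makes the reductions
`stub_chartPreDatum_toPreDatum_of` / `stub_acChartPreDatum_toPreDatum_of` unconditional.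
-/

set_option linter.dupNamespace false -- mandated namespace of this single-conjunct summit

namespace Summit.ResolutionOfSingularities.ResolutionOfSingularities.Theorems

open CategoryTheory AlgebraicGeometry TopologicalSpace Literature.AlgebraicGeometry.Resolution

/-- **Open pieces of the cobordant blow-up, unconditional** (registered stub `stub_openPieces` of line
`no-phi-rays-static-drop`): for a Rees algebra `R` on `Y`, an affine open `U`, `h ∈ Γ(Y, U)` and an
ideal sheaf `X`, the cobordant blow-up `B₊(D(h))` is an open piece of `B₊(U)` over `Y` with the same
strict transforms and exceptional divisor, containing every point of `B₊(U)` over `D(h)`.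
[cite: Wlodarczyk2022, Def. 2.3.5 and Def. 5.1.1] -/
theorem stub_openPieces :
    ∀ ⦃Y : Scheme.{0}⦄ (R : ReesAlgebraData Y) (U : Y.affineOpens) (h : Γ(Y, U)) (X : Y.IdealSheafData),
      ∃ j : R.cobordantPlus (Y.affineBasicOpen h) ⟶ R.cobordantPlus U, IsOpenImmersion j ∧
        j ≫ R.cobordantPlusι U = R.cobordantPlusι (Y.affineBasicOpen h) ∧
        (R.cobordantStrictTransform U X).comap j =
          R.cobordantStrictTransform (Y.affineBasicOpen h) X ∧
        (∀ b' : R.cobordantPlus (Y.affineBasicOpen h),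
          (affineCobordantBlowup.plusOpens (R.chartIdeals U)).ι (j b') ∈
              ((affineCobordantBlowup.exceptional (R.chartIdeals U)).support :
                Set (affineCobordantBlowup (R.chartIdeals U))) ↔
            (affineCobordantBlowup.plusOpens (R.chartIdeals (Y.affineBasicOpen h))).ι b' ∈
              ((affineCobordantBlowup.exceptional (R.chartIdeals (Y.affineBasicOpen h))).support :
                Set (affineCobordantBlowup (R.chartIdeals (Y.affineBasicOpen h))))) ∧
        (∀ b : R.cobordantPlus U, R.cobordantPlusι U b ∈ Y.basicOpen h → ∃ b', j b' = b) :=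
  stub_cobordantPlus_basicOpen_openImmersion
    (fun h _ I I' hI ψ hψ => stub_strictTransform_localization h I I' hI ψ hψ)

end Summit.ResolutionOfSingularities.ResolutionOfSingularities.Theorems
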